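import Summits.ResolutionOfSingularities.ResolutionOfSingularities.Theses.UniversalCells
import Literature.AlgebraicGeometry.Resolution.ResolutionOfSingularities
import Mathlib.FieldTheory.Perfect
import Summits.ResolutionOfSingularities.ResolutionOfSingularities.Theorems.UniversalCellsLocalToGlobalLocalUniformization
import HarnessLib

/-!
# Crux `CleanCovers.CoverResolution` (stmt-ResolutionOfSingularities-15104), line `strategy-split`
# v2.1: CALIBRATION of the local stub L against local uniformization and against the sibling crux
# `UniversalCells.LocalToGlobal`

Route `ResolutionOfSingularities/CleanCovers`, line lead (continuation seat c1)
`prover-line-stmt-ResolutionOfSingularities-15104-c1-0`, 2026-08-17. L (local resolution of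
Kedlaya covers along the hyperplane at infinity, written verbatim as a binder) implies pointwise
Zariski-local resolvability of every integral finite-type scheme over every perfect field
(LocRes_perfect; `locallyResolvable_perfect_of_boundaryLocalResolution`,
`Theorems/CleanCoversCoverResolutionLocallyResolvable.lean`). This file draws the two consequences
of LocRes_perfect (taken as the hypothesis, written verbatim; compose with that theorem for the
`L ⇒ …` forms):

* `relLUPerfect_of_locallyResolvablePerfect` (**LocRes_perfect ⇒ relative local uniformization
  over perfect fields**, the antecedent of the sibling crux `PatchingRelPerfect` / of `Valuative.PatchingRel`
  sliced at perfect ground fields): enlarge `R` by an affine model of `O` (`exists_affineModel`),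
  resolve locally around every point of the integral affine `Spec (R ⊔ A₀)`, and uniformize
  the valuation by the centre of `O` on a local resolution
  (`exists_affineModel_regular_of_locallyResolvable`). So the cleaning engine's target L is AT
  LEAST as strong as local uniformization over perfect fields: in the chain
  `ResPerfect ⇒ CoverResolution ⇒ L ⇒ LocRes_perfect ⇒ LU_perfect` every arrow is now a tree
  theorem, and modulo the shared patching atom T all five are equivalent.
* `resPrimeField_of_locallyResolvablePerfect_of_localToGlobal` (**LocRes_perfect ∧
  `UniversalCells.LocalToGlobal` ⇒ resolution of every integral separated finite-type
  `𝔽_p`-scheme**): an inter-route assembly — CleanCovers' local half (through LocRes_perfect) feeds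
  the antecedent `H_p` of UniversalCells' local-to-global crux at the (perfect) prime field.
-/

-- single-problem summit: the doubled namespace component `ResolutionOfSingularities` is forced
set_option linter.dupNamespace false

noncomputable section

namespace Summit.ResolutionOfSingularities.ResolutionOfSingularities.Theorems

open CategoryTheory AlgebraicGeometry TopologicalSpace
open Literature.AlgebraicGeometry.Resolution

/-- Pointwise local resolvability over `k` makes the spectrum of a finitely generated
`k`-subalgebra `R` of a field `K` locally resolvable at every point: `Spec R` is an integral
affine (hence separated, quasi-compact) scheme of finite type over `Spec k`. Field-agnostic twin
of `locallyResolvable_spec_subalgebra_of_locallyResolvable`. [folklore] -/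
theorem locallyResolvable_spec_subalgebra_of_locallyResolvable_field (k : Type) [Field k]
    (hloc : ∀ (X : Scheme.{0}) (f : X ⟶ Spec (.of k)), IsSeparated f →
      LocallyOfFiniteType f → QuasiCompact f → IsIntegral X →
        ∀ x : X, ∃ U : X.Opens, x ∈ U ∧ Scheme.HasResolution (U : Scheme.{0}))
    {K : Type} [Field K] [Algebra k K] (R : Subalgebra k K) (hRfg : R.FG) :
    ∀ x : Spec (.of R), ∃ W : (Spec (.of R)).Opens, x ∈ W ∧
      Scheme.HasResolution (W : Scheme.{0}) := by
  haveI : Algebra.FiniteType k R := R.fg_iff_finiteType.mp hRfg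
  let f : Spec (.of R) ⟶ Spec (.of k) := Spec.map (CommRingCat.ofHom (algebraMap k R))
  haveI : LocallyOfFiniteType f :=
    (HasRingHomProperty.Spec_iff (P := @LocallyOfFiniteType)).mpr
      (RingHom.finiteType_algebraMap.mpr ‹_›)
  haveI : IsDomain (CommRingCat.of R) := inferInstanceAs (IsDomain R)
  exact hloc (Spec (.of R)) f inferInstance inferInstance inferInstance inferInstance

/-- **LocRes_perfect ⇒ relative local uniformization over perfect fields.** If every point of
every integral separated finite-type scheme over every perfect field of characteristic `p` has a
resolvable open neighbourhood (in particular under L, by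
`locallyResolvable_perfect_of_boundaryLocalResolution`), then for every
perfect field `k` of characteristic `p`, every finitely generated `K/k`, every valuation ring
`O ∋ k` of `K` and every finitely generated `k`-subalgebra `R ⊆ O`, some finitely generated `A`
with `R ⊆ A ⊆ O`, `Frac A = K`, is regular at the centre of `O` (the antecedent of the sibling
crux `PatchingRelPerfect`). Proof: enlarge `R` by an affine model of `O`
(`exists_affineModel`) and uniformize by the centre of `O` on a local resolution of
`Spec (R ⊔ A₀)` (`exists_affineModel_regular_of_locallyResolvable`).
[cite: ZariskiSamuel1960, Ch. VI §17 (affine models and centres)] -/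
theorem relLUPerfect_of_locallyResolvablePerfect : (∀ p : ℕ, p.Prime → ∀ (k : Type) [Field k] [CharP k p] [PerfectField k] (X : AlgebraicGeometry.Scheme.{0}) (g : X ⟶ AlgebraicGeometry.Spec (.of k)), AlgebraicGeometry.IsSeparated g → AlgebraicGeometry.LocallyOfFiniteType g → AlgebraicGeometry.QuasiCompact g → AlgebraicGeometry.IsIntegral X → ∀ x : X, ∃ U : X.Opens, x ∈ U ∧ Literature.AlgebraicGeometry.Resolution.Scheme.HasResolution (U : AlgebraicGeometry.Scheme.{0})) → (∀ p : ℕ, p.Prime → ∀ (k K : Type) [Field k] [CharP k p] [PerfectField k] [Field K] [Algebra k K], (⊤ : IntermediateField k K).FG → ∀ O : ValuationSubring K, (∀ c : k, algebraMap k K c ∈ O) → ∀ R : Subalgebra k K, R.FG → R.toSubring ≤ O.toSubring → ∃ (A : Subalgebra k K) (h : A.toSubring ≤ O.toSubring), R ≤ A ∧ A.FG ∧ IsFractionRing A K ∧ IsRegularLocalRing (Localization.AtPrime (Ideal.comap (Subring.inclusion h) (IsLocalRing.maximalIdeal O)))) := by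
  intro hLoc p hp k K _ _ _ _ _ hKfg O hO R hRfg hRO
  classical
  have hloc := hLoc p hp k
  obtain ⟨A₀, hA₀O, hA₀fg, hA₀fr⟩ := exists_affineModel k K hKfg O hO
  have hR'O : (R ⊔ A₀).toSubring ≤ O.toSubring := by
    let Oalg : Subalgebra k K := { O.toSubring with algebraMap_mem' := hO }
    change R ⊔ A₀ ≤ Oalg
    exact sup_le (fun x hx => hRO hx) (fun x hx => hA₀O hx)
  have hR'fr : IsFractionRing ↥(R ⊔ A₀) K := isFractionRing_of_le le_sup_right hA₀fr
  have hR'fg : (R ⊔ A₀).FG := hRfg.sup hA₀fg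
  obtain ⟨A, hA, hle, hAfg, hreg⟩ :=
    exists_affineModel_regular_of_locallyResolvable O (R ⊔ A₀) hR'O hR'fg hR'fr
      (locallyResolvable_spec_subalgebra_of_locallyResolvable_field k
        (fun X f hs hl hq hi => hloc X f hs hl hq hi) (R ⊔ A₀) hR'fg)
  exact ⟨A, hA, le_sup_left.trans hle, hAfg, isFractionRing_of_le hle hR'fr, hreg⟩

/-- **LocRes_perfect ∧ `UniversalCells.LocalToGlobal` ⇒ resolution over `𝔽_p`** (inter-route
assembly; with L through `locallyResolvable_perfect_of_boundaryLocalResolution`): LocRes_perfect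
at the perfect field `𝔽_p` is the antecedent `H_p` of the sibling crux (pointwise local resolvability of integral
separated finite-type `𝔽_p`-schemes; `𝔽_p` is perfect), whose conclusion is resolution of every
such scheme. [folklore] -/
theorem resPrimeField_of_locallyResolvablePerfect_of_localToGlobal : (∀ p : ℕ, p.Prime → ∀ (k : Type) [Field k] [CharP k p] [PerfectField k] (X : AlgebraicGeometry.Scheme.{0}) (g : X ⟶ AlgebraicGeometry.Spec (.of k)), AlgebraicGeometry.IsSeparated g → AlgebraicGeometry.LocallyOfFiniteType g → AlgebraicGeometry.QuasiCompact g → AlgebraicGeometry.IsIntegral X → ∀ x : X, ∃ U : X.Opens, x ∈ U ∧ Literature.AlgebraicGeometry.Resolution.Scheme.HasResolution (U : AlgebraicGeometry.Scheme.{0})) → Summit.ResolutionOfSingularities.ResolutionOfSingularities.Theses.UniversalCells.LocalToGlobal → ∀ p : ℕ, p.Prime → ∀ (X : AlgebraicGeometry.Scheme.{0}) (f : X ⟶ AlgebraicGeometry.Spec (.of (ZMod p))), AlgebraicGeometry.IsSeparated f → AlgebraicGeometry.LocallyOfFiniteType f → AlgebraicGeometry.QuasiCompact f → AlgebraicGeometry.IsIntegral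 X → Literature.AlgebraicGeometry.Resolution.Scheme.HasResolution X := by
  intro hLoc hLG p hp X f hs hl hq hi
  haveI : Fact p.Prime := ⟨hp⟩
  exact hLG p hp (fun Y g hs' hl' hq' hi' => hLoc p hp (ZMod p) Y g hs' hl' hq' hi') X f hs hl hq hi

end Summit.ResolutionOfSingularities.ResolutionOfSingularities.Theorems

end
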